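import Summits.QuantumAdvantage.QuantumAdvantage.Theorems.NearExactIsExact.Negative.DualPair

/-!
# `NearExactIsExact` (stmt-QuantumAdvantage-14043) — negative lemma: the SPLIT dual pair
  (gen 44 disprover; the mechanism behind most horizontal dual pairs of the two-sided `naff = 4` census, DISPROOF.md §49.3–49.5)

In the setting of `Negative/DualPair` (`c₁ ⊕ c₂∘π = 1_U`, `S₀ = σ₀(𝔽₂⁵)` an affine 5-flat, `S₁ = σ₁(𝔽₂⁵)` with
`π∘σ₁ = π∘σ₀ ⊕ e`) the only condition is that `S₁` be cubic-even.  Besides "affine of quadratic rank one"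
(`dual_pair_rank_one`: `σ₁ = A ⊕ q·F`, `q` quadratic, `F` constant) there is a second elementary shape:

* `comp_deg_affine_split` / `sum_cubic_affine_split`: `σ₁ = A ⊕ λ·W` with `A` affine, `λ` ONE affine
  functional and `W` an affine VECTOR field (all quadratic parts of `σ₁` share the linear factor `λ`); then
  `c∘σ₁ = c∘A ⊕ λ·(c∘A ⊕ c∘(A ⊕ W))` has degree `≤ 1 + 3 = 4`, so `S₁` — the union of the two affine
  4-flats `A({λ = 0})` and `(A ⊕ W)({λ = 1})` — is cubic-even;
* `dual_pair_split`: the resulting parity lemma (even total `U`-mass).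

Why it matters (pilot of 25 two-sided stratum-(I) maps, DISPROOF.md §49.3–49.5; data about the lemma, not used by it):
for a target vector `e` with zero frame part the transported translation `τ_e` restricted to the zero section is
quadratic, and among the 3 968 (map, side, e) cases in which EVERY base hyperplane avoiding `u*` yields a dual pair,
in 3 128 (79 %) all eleven quadratic parts share one common linear factor `λ` — the split shape of this file — and in
1 808 of those `λ` is the base twist form `l` of `γ(ū,ü) = (ū, ü ⊕ g(ū) ⊕ l(ū)Kü)`.  For the synthetic family
"π fibrewise affine with quadratic inversion data, σ fibrewise quadratic" the factor `λ = l` is forced (paper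
computation, §49.4), so there every hyperplane works.  The remaining 21 % are covered by `dual_pair` with `S₁`
cubic-even for other reasons (e.g. `dual_pair_rank_one`, or degree-4 cancellations between coordinates).

HONEST FRAMING: a kernel-checked census-free parity lemma on the negative side of `NearExactIsExact`; NOT summit
progress; it refutes nothing by itself.
-/

set_option linter.dupNamespace false -- D-0017: single-problem summit ⇒ `QuantumAdvantage.QuantumAdvantage` by design

namespace Summit.QuantumAdvantage.QuantumAdvantage.Theorems.NearExactIsExact.Negative.DualPairSplit

open Finset
open Literature.Computability.QuantumComplexity
open Literature.Computability.QuantumComplexity.BuzetChailloux (bxor)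
open Summit.QuantumAdvantage.QuantumAdvantage.Theorems.CubicForrelation.NearExactIsExact
  (fc_isDegLeFun_comp fc_deg_bxor te_isDegLeFun_band)
open Summit.QuantumAdvantage.QuantumAdvantage.Theorems.NearExactIsExact.Negative.SkewProductCore
open Summit.QuantumAdvantage.QuantumAdvantage.Theorems.NearExactIsExact.Negative.ReflectedFlatPair
  (sum_ind_eq_zero_of_deg_four)
open Summit.QuantumAdvantage.QuantumAdvantage.Theorems.NearExactIsExact.Negative.DualPair
  (dual_pair taylor_one_dir)

/-- **Cubic ∘ (affine ⊕ λ·W) has degree `≤ 4`** (`A` affine, `λ` an affine functional, `W` an affine vector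
field): `c(A ⊕ λW) = c(A) ⊕ λ·(c(A) ⊕ c(A ⊕ W))`, degrees `3` and `1 + 3`. [folklore] -/
theorem comp_deg_affine_split {m n : ℕ} (c : (Fin n → Bool) → Bool) (hc : IsDegLeFun 3 c)
    (A : (Fin m → Bool) → (Fin n → Bool)) (hA : ∀ j, IsDegLeFun 1 (fun v => A v j))
    (W : (Fin m → Bool) → (Fin n → Bool)) (hW : ∀ j, IsDegLeFun 1 (fun v => W v j))
    (lam : (Fin m → Bool) → Bool) (hlam : IsDegLeFun 1 lam) :
    IsDegLeFun 4 (fun v => c (bxor (A v) (fun j => lam v && W v j))) := by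
  have h0 : IsDegLeFun 3 (fun v : Fin m → Bool => c (A v)) := fc_isDegLeFun_comp hc A hA (by norm_num)
  have hAW : ∀ j, IsDegLeFun 1 (fun v : Fin m → Bool => bxor (A v) (W v) j) :=
    fun j => fc_deg_bxor (hA j) (hW j)
  have h1 : IsDegLeFun 3 (fun v : Fin m → Bool => c (bxor (A v) (W v))) :=
    fc_isDegLeFun_comp hc (fun v => bxor (A v) (W v)) hAW (by norm_num)
  have e : (fun v => c (bxor (A v) (fun j => lam v && W v j))) =
      fun v => (c (A v) ^^ (lam v && (c (A v) ^^ c (bxor (A v) (W v))))) :=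
    funext fun v => taylor_one_dir c (A v) (W v) (lam v)
  rw [e]
  exact fc_deg_bxor (h0.mono (by norm_num)) ((te_isDegLeFun_band hlam (fc_deg_bxor h0 h1)).mono (by norm_num))

/-- A set parametrised by `𝔽₂⁵` as `A ⊕ λ·W` (`A`, `W` affine, `λ` an affine functional) — the union of two
affine 4-flats — is cubic-even. [folklore] -/
theorem sum_cubic_affine_split {n : ℕ} (A : (Fin 5 → Bool) → (Fin n → Bool))
    (hA : ∀ j, IsDegLeFun 1 (fun v => A v j)) (W : (Fin 5 → Bool) → (Fin n → Bool))
    (hW : ∀ j, IsDegLeFun 1 (fun v => W v j)) (lam : (Fin 5 → Bool) → Bool) (hlam : IsDegLeFun 1 lam)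
    (σ₁ : (Fin 5 → Bool) → (Fin n → Bool)) (hσ₁ : ∀ v, σ₁ v = bxor (A v) (fun j => lam v && W v j)) :
    ∀ c : (Fin n → Bool) → Bool, IsDegLeFun 3 c → ∑ v, ind (c (σ₁ v)) = 0 := by
  intro c hc
  have e : (fun v : Fin 5 → Bool => c (σ₁ v)) = fun v => c (bxor (A v) (fun j => lam v && W v j)) :=
    funext fun v => by rw [hσ₁ v]
  have h4 : IsDegLeFun 4 (fun v : Fin 5 → Bool => c (σ₁ v)) := by
    rw [e]; exact comp_deg_affine_split c hc A hA W hW lam hlam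
  exact sum_ind_eq_zero_of_deg_four h4

/-- **SPLIT DUAL PAIR.** `c₁ ⊕ c₂∘π = U`, `σ₀` affine with `π∘σ₀` quadratic, `σ₁ = A ⊕ λ·W` (`A`, `W` affine,
`λ` an affine functional) with `π∘σ₁ = π∘σ₀ ⊕ e` ⇒ even total `U`-mass. [folklore] -/
theorem dual_pair_split {n : ℕ} (π : (Fin n → Bool) → (Fin n → Bool))
    (c₁ c₂ : (Fin n → Bool) → Bool) (h₁ : IsDegLeFun 3 c₁) (h₂ : IsDegLeFun 3 c₂)
    (U : (Fin n → Bool) → Bool) (hres : ∀ z, (c₁ z ^^ c₂ (π z)) = U z)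
    (σ₀ : (Fin 5 → Bool) → (Fin n → Bool)) (hσ₀ : ∀ j, IsDegLeFun 1 (fun v => σ₀ v j))
    (A : (Fin 5 → Bool) → (Fin n → Bool)) (hA : ∀ j, IsDegLeFun 1 (fun v => A v j))
    (W : (Fin 5 → Bool) → (Fin n → Bool)) (hW : ∀ j, IsDegLeFun 1 (fun v => W v j))
    (lam : (Fin 5 → Bool) → Bool) (hlam : IsDegLeFun 1 lam)
    (σ₁ : (Fin 5 → Bool) → (Fin n → Bool)) (hσ₁ : ∀ v, σ₁ v = bxor (A v) (fun j => lam v && W v j))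
    (hπ : ∀ j, IsDegLeFun 2 (fun v => π (σ₀ v) j)) (e : Fin n → Bool)
    (hrefl : ∀ v, π (σ₁ v) = bxor (π (σ₀ v)) e) :
    ∑ v, ind (U (σ₀ v)) + ∑ v, ind (U (σ₁ v)) = 0 :=
  dual_pair π c₁ c₂ h₁ h₂ U hres σ₀ σ₁ hσ₀ hπ e hrefl (sum_cubic_affine_split A hA W hW lam hlam σ₁ hσ₁)

/-- **SPLIT DUAL PAIR (kill).** As `dual_pair_split`, with `U`-masses `1` and `0`: impossible. [folklore] -/
theorem dual_pair_split_kill {n : ℕ} (π : (Fin n → Bool) → (Fin n → Bool))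
    (c₁ c₂ : (Fin n → Bool) → Bool) (h₁ : IsDegLeFun 3 c₁) (h₂ : IsDegLeFun 3 c₂)
    (U : (Fin n → Bool) → Bool) (hres : ∀ z, (c₁ z ^^ c₂ (π z)) = U z)
    (σ₀ : (Fin 5 → Bool) → (Fin n → Bool)) (hσ₀ : ∀ j, IsDegLeFun 1 (fun v => σ₀ v j))
    (A : (Fin 5 → Bool) → (Fin n → Bool)) (hA : ∀ j, IsDegLeFun 1 (fun v => A v j))
    (W : (Fin 5 → Bool) → (Fin n → Bool)) (hW : ∀ j, IsDegLeFun 1 (fun v => W v j))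
    (lam : (Fin 5 → Bool) → Bool) (hlam : IsDegLeFun 1 lam)
    (σ₁ : (Fin 5 → Bool) → (Fin n → Bool)) (hσ₁ : ∀ v, σ₁ v = bxor (A v) (fun j => lam v && W v j))
    (hπ : ∀ j, IsDegLeFun 2 (fun v => π (σ₀ v) j)) (e : Fin n → Bool)
    (hrefl : ∀ v, π (σ₁ v) = bxor (π (σ₀ v)) e)
    (h0 : ∑ v, ind (U (σ₀ v)) = 1) (h1 : ∀ v, U (σ₁ v) = false) : False := by
  have h := dual_pair_split π c₁ c₂ h₁ h₂ U hres σ₀ hσ₀ A hA W hW lam hlam σ₁ hσ₁ hπ e hrefl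
  rw [h0, sum_congr rfl (fun v _ => by rw [h1 v, ind_false]), sum_const_zero, add_zero] at h
  exact one_ne_zero h
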